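import Mathlib
import HarnessLib
import Literature.Combinatorics.Additive.StepBeyondKempermanUniqueSums
import Literature.Combinatorics.Additive.StepBeyondKempermanCriticalExtension

/-!
# Grynkiewicz 2009, §6: «the quasi-period from KST must be `G`» — (17) is excluded for a pair whose
# first member is a generating set two steps away from quasi-periodic sets and from progressions

[cite: Grynkiewicz2009, §6 Claim 9 (proof of Thm 4.1, p. 28)] [tag: critical-pair] [tag: inverse-theorem]

Topic `Literature/Combinatorics/Additive`.  Cell `mm-stpp` (D-0046), seat `mm-stpp-lit` (gen 24); the
port of D. J. Grynkiewicz, *A step beyond Kemperman's structure theorem*, Mathematika **55** (2009)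
67–114 continued.  The recurring KST step of the deep core of §6 (Claim 9, p. 28; again in Subcase 4,
p. 33, for `(A ∪ {α}) + ((B + {0, d}) ∪ {β})` and for `(A + {0, d}, B)`), printed in Claim 9 as:

«Suppose (17) holds for `A` and `B ∖ b`.  In view of Corollary 4.2, it follows that if the sumset of the
extended pair `A ∪ {α}` and `B ∖ b ∪ {β}` is periodic without a unique expression element, then
`(A ∪ {α}) + (B ∖ b ∪ {β}) = A + (B ∖ b)`.  Thus, since `A + (B ∖ b)` is aperiodic, it follows that we
can in all cases apply KST to `A′ = A ∪ {α}` and `B′ = B ∖ b ∪ {β}`.  Since `d⊆(A, QP) ≥ 2` (eq. 47), it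
follows that `d⊆(A′, QP) ≥ 1`.  Hence, since `⟨A⟩ = G` (Claim 4), it follows that KST can only hold with
subgroup `G`, whence either `|A + B| ≥ |A′ + B′| − 1 ≥ |G| − 2`, or else `d⊆(A, AP) ≤ 1`, both
contradictions (to Claim 5 or (51)).  Therefore we can assume (17) does not hold.»

HOW IT IS MIRRORED.
* «we can in all cases apply KST»: if the pair `(A, B′)` is non-extendible, the extension
  `(A ∪ {α}) + (B′ ∪ {β})` is aperiodic by Corollary 4.2's first assertion
  (`addStab_insert_add_insert_eq`, `StepBeyondKempermanCriticalExtension.lean`); if it is extendible,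
  (17) is re-chosen degenerate (one new element only) with sumset `A + B′` itself, aperiodic by
  hypothesis — `exists_critical_extension`.  KST is the tree's `exists_isKempermanDecompI_of_not_isPeriodic'`.
* «`d⊆(A′, QP) ≥ 1` … KST can only hold with subgroup `G`»: `IsKempermanDecompI.eq_top_of_subset`
  (a Kemperman decomposition of a pair whose first member contains, up to one element, a generating set
  `A ∋ 0` with `d⊆(A, QP) ≥ 2` has quasi-period `G` and trivial periodic parts).
* «either `|A′ + B′| ≥ |G| − 1` [types (III), (IV)], or `d⊆(A, AP) ≤ 1` [type (II)]» (type (I) being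
  excluded by `|A′|, |B′| ≥ 2`): `IsKempermanDecompI.alternatives_of_top`, and the assembled
  **`not_seventeen_of_two_le_subsetDist`**: `0 ∈ A`, `|A|, |B′| ≥ 2`, `|A + B′| = |A| + |B′|`, `A + B′`
  aperiodic, `⟨A⟩ = G`, `d⊆(A, QP) ≥ 2`, `d⊆(A, QAP_d) ≥ 2` for all `d ≠ 0` (display (50), which implies the
  printed (51)), and `|A + B′| ≤ |G| − 3` ⟹ (17) fails for `(A, B′)`.

WHAT THIS FILE IS NOT: no new definitions, no named facts; Claim 9 itself (which also needs Lemma 5.11,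
the induction on `|B|`, Lemma 5.4 and the terminal computation `claim9_terminal`) is not assembled here.

## References
* D. J. Grynkiewicz, *A step beyond Kemperman's structure theorem*, Mathematika 55 (2009) 67–114,
  doi:10.1112/S0025579300000966; §6 Claim 9 (p. 28), Subcase 4 (p. 33), §2 KST, Cor 4.2 (held
  `paper:doi-10-1112-s0025579300000966`, pp. 28, 33 read 2026-08-29) [cite: Grynkiewicz2009, §6 Claim 9].
* J. H. B. Kemperman, *On small sumsets in an abelian group*, Acta Math. 103 (1960) 63–88, Thm 5.1 —
  the tree's `exists_isKempermanDecompI_of_not_isPeriodic'` [cite: Kemperman1960, Thm 5.1].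
-/

namespace Literature.Combinatorics.Additive

open Finset
open scoped Pointwise

universe u

variable {G : Type u} [AddCommGroup G] [DecidableEq G]

namespace IsKempermanDecompI

/-- «Since `d⊆(A, QP) ≥ 2`, it follows that `d⊆(A′, QP) ≥ 1`.  Hence, since `⟨A⟩ = G`, it follows that KST
can only hold with subgroup `G`»: a Kemperman decomposition of `(A′, B′)`, where `A ⊆ A′ ⊆ A ∪ {α}`,
`0 ∈ A`, `⟨A⟩ = G` and `d⊆(A, QP) ≥ 2`, has quasi-period `G`, and both periodic parts are empty.
[cite: Grynkiewicz2009, §6 Claim 9 (p. 28)] -/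
theorem eq_top_of_subset {L : AddSubgroup G} {A A' B' A₁ A₀ B₁ B₀ : Finset G}
    (hK : IsKempermanDecompI L A' B' A₁ A₀ B₁ B₀) (hAA' : A ⊆ A') (h1 : #(A' \ A) ≤ 1)
    (h0A : (0 : G) ∈ A) (hgen : AddSubgroup.closure (A : Set G) = ⊤)
    (hAqp : 2 ≤ subsetDist A {P | IsQuasiPeriodic P}) :
    L = ⊤ ∧ A₁ = ∅ ∧ A₀ = A' ∧ B₁ = ∅ ∧ B₀ = B' := by
  have hA'qp : ¬ IsQuasiPeriodic A' := by
    intro hqp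
    have h := hAqp.trans (subsetDist_le (𝒮 := {P | IsQuasiPeriodic P}) hqp hAA')
    norm_cast at h
    omega
  obtain ⟨hA₁, hA₀⟩ := hK.decomp_left.left_eq_empty_of_not_isQuasiPeriodic hA'qp
  have hLtop : L = ⊤ := by
    refine Grynkiewicz2009.eq_top_of_coset_of_closure_eq_top (a := 0) h0A hgen fun x hx => ?_
    exact hK.decomp_left.sub_mem x (by rw [hA₀]; exact hAA' hx) 0 (by rw [hA₀]; exact hAA' h0A)
  subst hLtop
  have hB₁ : B₁ = ∅ := by
    by_contra hne
    obtain ⟨y, hy⟩ := nonempty_iff_ne_empty.2 hne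
    obtain ⟨z, hz⟩ := hK.right_nonempty
    have hzB₁ : z ∈ B₁ := by
      have := hK.decomp_right.periodic.add_mem (AddSubgroup.mem_top (z - y)) hy
      rwa [sub_add_cancel] at this
    exact disjoint_left.1 hK.decomp_right.disjoint hzB₁ hz
  have hB₀ : B₀ = B' := by
    have := hK.decomp_right.union_eq
    rwa [hB₁, empty_union] at this
  exact ⟨rfl, hA₁, hA₀, hB₁, hB₀⟩

/-- With quasi-period `G` the pair `(A′, B′)` is itself elementary: «either `|A′ + B′| ≥ |G| − 1`»
(types (III): `|A′| + |B′| = |G| + 1`, and (IV): `|A′| + |B′| = |G|`), «or else `d⊆(A, AP) ≤ 1`»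
(type (II): `A′` is a progression whose difference has order `≥ |A′| + |B′| − 1`), or `|A′| = 1` or
`|B′| = 1` (type (I)).  Same hypotheses as `eq_top_of_subset`, `G` finite.
[cite: Grynkiewicz2009, §6 Claim 9 (p. 28)] -/
theorem alternatives_of_top [Fintype G] {L : AddSubgroup G} {A A' B' A₁ A₀ B₁ B₀ : Finset G}
    (hK : IsKempermanDecompI L A' B' A₁ A₀ B₁ B₀) (hAA' : A ⊆ A') (h1 : #(A' \ A) ≤ 1)
    (h0A : (0 : G) ∈ A) (hgen : AddSubgroup.closure (A : Set G) = ⊤)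
    (hAqp : 2 ≤ subsetDist A {P | IsQuasiPeriodic P}) :
    (#A' = 1 ∨ #B' = 1) ∨
      (∃ d : G, IsAP A' d ∧ IsAP B' d ∧ (addOrderOf d = 0 ∨ #A' + #B' - 1 ≤ addOrderOf d)) ∨
      Fintype.card G ≤ #A' + #B' := by
  obtain ⟨hL, hA₁, hA₀, hB₁, hB₀⟩ := hK.eq_top_of_subset hAA' h1 h0A hgen hAqp
  have hE := hK.elementary
  rw [hA₀, hB₀] at hE
  have h0A' : (0 : G) ∈ A' := hAA' h0A
  rcases hE with hI | hII | hIII | hIV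
  · exact Or.inl hI.2.2
  · obtain ⟨-, -, d, hAd, hBd, hord⟩ := hII
    exact Or.inr (Or.inl ⟨d, hAd, hBd, hord⟩)
  · obtain ⟨K, a, b, -, -, hAK, -, hcard, -⟩ := hIII
    have hKtop : K = ⊤ :=
      Grynkiewicz2009.eq_top_of_coset_of_closure_eq_top h0A hgen fun x hx => hAK x (hAA' hx)
    subst hKtop
    rw [AddSubgroup.card_top, Nat.card_eq_fintype_card] at hcard
    exact Or.inr (Or.inr (by omega))
  · obtain ⟨K, a, b, g, -, -, hAK, -, -, -, -, hiff⟩ := hIV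
    have hKtop : K = ⊤ :=
      Grynkiewicz2009.eq_top_of_coset_of_closure_eq_top h0A hgen fun x hx => hAK x (hAA' hx)
    subst hKtop
    have hAeq : A' = (B'ᶜ).image (fun y => g - y) := by
      ext x
      rw [mem_image]
      constructor
      · intro hx
        exact ⟨g - x, mem_compl.2 ((hiff x).1 hx).2, sub_sub_cancel g x⟩
      · rintro ⟨y, hy, rfl⟩
        exact (hiff _).2 ⟨AddSubgroup.mem_top _, by rw [sub_sub_cancel]; exact mem_compl.1 hy⟩
    have hcardA : #A' = Fintype.card G - #B' := by
      rw [hAeq, card_image_of_injective _ sub_right_injective, card_compl]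
    have := card_le_univ B'
    exact Or.inr (Or.inr (by omega))

end IsKempermanDecompI

namespace Grynkiewicz2009

/-- «In view of Corollary 4.2 … we can in all cases apply KST»: if (17) holds for a pair `(A, B′)` with
`|A + B′| = |A| + |B′|` and `A + B′` aperiodic, then some pair `A ⊆ A″ ⊆ A ∪ {·}`, `B′ ⊆ B″ ⊆ B′ ∪ {·}` is
critical with APERIODIC sumset of size at most `|A + B′| + 1` — the printed extension when `(A, B′)` is
non-extendible (Corollary 4.2, first assertion), a one-sided extension with sumset `A + B′` otherwise.
[cite: Grynkiewicz2009, §6 Claim 9 (p. 28) and Cor 4.2] -/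
theorem exists_critical_extension {A B' : Finset G} (hAB : #(A + B') = #A + #B')
    (haper : (A + B').addStab = {0})
    (h17 : ∃ α β : G, #(insert α A + insert β B') + 1 = #(insert α A) + #(insert β B')) :
    ∃ A'' B'' : Finset G, A ⊆ A'' ∧ #(A'' \ A) ≤ 1 ∧ B' ⊆ B'' ∧ #(B'' \ B') ≤ 1 ∧
      #(A'' + B'') + 1 = #A'' + #B'' ∧ (A'' + B'').addStab = {0} ∧ #(A'' + B'') ≤ #(A + B') + 1 := by
  obtain ⟨α, β, h17⟩ := h17
  by_cases hneA : IsNonExtendible A B'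
  · by_cases hneB : IsNonExtendible B' A
    · -- the non-extendible case: Corollary 4.2
      obtain ⟨hα, hβ⟩ := notMem_of_seventeen hAB hneA hneB h17
      refine ⟨insert α A, insert β B', subset_insert α A, ?_, subset_insert β B', ?_, h17,
        addStab_insert_add_insert_eq hAB hneA hneB h17, ?_⟩
      · rw [insert_sdiff_of_notMem A hα, sdiff_self, bot_eq_empty, Finset.insert_empty, card_singleton]
      · rw [insert_sdiff_of_notMem B' hβ, sdiff_self, bot_eq_empty, Finset.insert_empty, card_singleton]
      · rw [card_insert_of_notMem hα, card_insert_of_notMem hβ] at h17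
        omega
    · -- `B′` extendible: `A + (B′ ∪ {β′}) = A + B′`
      unfold IsNonExtendible at hneB
      push Not at hneB
      obtain ⟨β', hβ', heq⟩ := hneB
      rw [add_comm (insert β' B') A, add_comm B' A] at heq
      refine ⟨A, insert β' B', Subset.rfl, by rw [sdiff_self]; exact Nat.zero_le _,
        subset_insert β' B', ?_, ?_, by rwa [heq], by rw [heq]; exact Nat.le_succ _⟩
      · rw [insert_sdiff_of_notMem B' hβ', sdiff_self, bot_eq_empty, Finset.insert_empty, card_singleton]
      · rw [heq, hAB, card_insert_of_notMem hβ']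
        omega
  · -- `A` extendible: `(A ∪ {α′}) + B′ = A + B′`
    unfold IsNonExtendible at hneA
    push Not at hneA
    obtain ⟨α', hα', heq⟩ := hneA
    refine ⟨insert α' A, B', subset_insert α' A, ?_, Subset.rfl, by rw [sdiff_self]; exact Nat.zero_le _,
      ?_, by rwa [heq], by rw [heq]; exact Nat.le_succ _⟩
    · rw [insert_sdiff_of_notMem A hα', sdiff_self, bot_eq_empty, Finset.insert_empty, card_singleton]
    · rw [heq, hAB, card_insert_of_notMem hα']
      omega

/-- **(17) is excluded** (§6 Claim 9, p. 28, the paragraph quoted in the module docstring; the same step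
recurs on p. 33).  Let `G` be finite, `0 ∈ A`, `|A|, |B′| ≥ 2`, `|A + B′| = |A| + |B′|` with `A + B′`
aperiodic and `|A + B′| ≤ |G| − 3`, `⟨A⟩ = G`, `d⊆(A, QP) ≥ 2` (display (47)) and `d⊆(A, QAP_d) ≥ 2` for
every `d ≠ 0` (display (50), implying the printed (51) `d⊆(A, AP) ≥ 2`).  Then (17) fails for `(A, B′)`:
there are no `α, β` with `|(A ∪ {α}) + (B′ ∪ {β})| = |A ∪ {α}| + |B′ ∪ {β}| − 1`.
[cite: Grynkiewicz2009, §6 Claim 9 (proof of Thm 4.1, p. 28)] -/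
theorem not_seventeen_of_two_le_subsetDist [Fintype G] {A B' : Finset G} (h0A : (0 : G) ∈ A)
    (hA2 : 2 ≤ #A) (hB2 : 2 ≤ #B') (hAB : #(A + B') = #A + #B') (haper : (A + B').addStab = {0})
    (hG : #(A + B') + 3 ≤ Fintype.card G) (hgen : AddSubgroup.closure (A : Set G) = ⊤)
    (hAqp : 2 ≤ subsetDist A {P | IsQuasiPeriodic P})
    (hAap : ∀ d : G, d ≠ 0 → 2 ≤ subsetDist A {P | IsQuasiProgression d P}) :
    ¬ ∃ α β : G, #(insert α A + insert β B') + 1 = #(insert α A) + #(insert β B') := by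
  intro h17
  have hAne : A.Nonempty := card_pos.1 (by omega)
  have hBne : B'.Nonempty := card_pos.1 (by omega)
  obtain ⟨A'', B'', hAA, hA1, hBB, hB1, hcrit, hap, hle⟩ :=
    exists_critical_extension hAB haper h17
  have hA''ne : A''.Nonempty := hAne.mono hAA
  have hB''ne : B''.Nonempty := hBne.mono hBB
  have hA''2 : 2 ≤ #A'' := hA2.trans (card_le_card hAA)
  have hB''2 : 2 ≤ #B'' := hB2.trans (card_le_card hBB)
  haveI : Nontrivial G := by
    rw [← Fintype.one_lt_card_iff_nontrivial]
    exact lt_of_lt_of_le (by omega : 1 < #A) (card_le_univ A)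
  have hnp : ¬ IsPeriodic (A'' + B'') := fun h =>
    (isPeriodic_iff_addStab_ne (hA''ne.add hB''ne)).1 h hap
  obtain ⟨L, A₁, A₀, B₁, B₀, hK⟩ :=
    exists_isKempermanDecompI_of_not_isPeriodic' hA''ne hB''ne hcrit.le hnp
  rcases hK.alternatives_of_top hAA hA1 h0A hgen hAqp with hI | ⟨d, hAd, -, hord⟩ | hbig
  · omega
  · -- type (II): `A″` is a progression, so `d⊆(A, QAP_d) ≤ 1`
    have hd : d ≠ 0 := hAd.ne_zero (by omega)
    obtain ⟨a, hAeq⟩ := hAd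
    have hqp : IsQuasiProgression d A'' := by
      rw [hAeq]
      refine isQuasiProgression_apFinset (by omega) (card_apFinset_of_addOrderOf a d ?_)
      rcases hord with h0 | hle'
      · exact Or.inl h0
      · exact Or.inr (by omega)
    have h := (hAap d hd).trans (subsetDist_le (𝒮 := {P | IsQuasiProgression d P}) hqp hAA)
    norm_cast at h
    omega
  · -- types (III), (IV): `|A″ + B″| ≥ |G| − 1`
    omega

end Grynkiewicz2009

end Literature.Combinatorics.Additive
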